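import Summits.CriticalPhenomena.PercolationContinuityZ3.Theorems.Transplant.PlanarSkeletonFrmFromDefs
import Summits.CriticalPhenomena.PercolationContinuityZ3.Theorems.Transplant.SkelFrmFrom1ReachRadQV
import Summits.CriticalPhenomena.PercolationContinuityZ3.Theorems.Transplant.SkelFrm1ReachRadQV
import Summits.CriticalPhenomena.PercolationContinuityZ3.Theorems.Transplant.SkelFrmFrom1ReachRadQUV
import Summits.CriticalPhenomena.PercolationContinuityZ3.Theorems.Transplant.SkelFrm1ReachRadQUV
import Summits.CriticalPhenomena.PercolationContinuityZ3.Theorems.Transplant.SkelPhiReachOblAxes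
import Summits.CriticalPhenomena.PercolationContinuityZ3.Theorems.Transplant.SkelFrmFrom1ChoiceLTK
import Summits.CriticalPhenomena.PercolationContinuityZ3.Theorems.Transplant.SkelFrm1ChoiceLTK
import Summits.CriticalPhenomena.PercolationContinuityZ3.Theorems.Transplant.SkelFrmFromBParamsCorrKGLen
import Summits.CriticalPhenomena.PercolationContinuityZ3.Theorems.Transplant.SkelFrmBParamsCorrKGLen
import Summits.CriticalPhenomena.PercolationContinuityZ3.Theorems.Transplant.SkelPhiCorridorKGBoxes2
import Summits.CriticalPhenomena.PercolationContinuityZ3.Theorems.Transplant.SkelFrmFromBChoiceHYV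
import Summits.CriticalPhenomena.PercolationContinuityZ3.Theorems.Transplant.SkelFrmBChoiceHYV
import HarnessLib
import Summits.CriticalPhenomena.PercolationContinuityZ3.Theorems.Transplant.SkelFrm1ReachHoldsQ3V
/-!
# U-WAVE PORT (RULING D-U, lead g21 2026-08-26; WAVE-U-MANIFEST v3.0 row «SkelFrm1ReachHoldsQ3V» ↦ «SkelFrmFrom1ReachHoldsQ3V») of the tree module
# `Transplant/SkelFrm1ReachHoldsQ3V` onto the carrier `PlanarSkeletonFrmFrom` (frames only, cylinders connected from width `ℓ₀` on)

ORIGINAL TITLE: N2 (frames-only node `SamePDropOfSkeletonFrm₁`, OPEN), (C) column, THE TARGET OF RECORD (step 1, slot-robust form):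

builds on p205010 (kernel theorem, internal audit signed; external expert review pending) — nothing in this file uses p205010; NOTHING is claimed about the
OPEN node U `SamePDropOfSkeletonFrmFrom₁` (nor U_s / the end state).  Lane `prim-bschramm`, seat `prim-bschramm-p3` gen 26; helper file
(`--supports stmt-CriticalPhenomena-4575 --as helper`).  PORT RULES r1–r4 of RULING D-U: declaration order and proof texts are those of the original,
byte-identical except (i) the carrier token `PlanarSkeletonFrm ↦ PlanarSkeletonFrmFrom` (binders, `namespace`/`end` lines, qualified names of twinned
declarations), (ii) carrier-FREE declarations of the original (φ-level `Skelφ…` blocks and namespace-only arithmetic residents) are NOT re-declared —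
this file imports the original and `export`s the twin-free residents (POLICY T / treatment (m1)); residents whose statement mentions a twinned
constant are copied, (iii) every carrier-binding declaration keeps its explicit binder `(Φ : PlanarSkeletonFrmFrom G)` in its own signature (r2).  Docstrings and citations are the original's.
-/

open scoped Classical

noncomputable section

namespace Summit.CriticalPhenomena.PercolationContinuityZ3.Theorems.Transplant

namespace PlanarSkeletonFrmFrom

open Literature.Probability.Percolation Literature.Probability.LatticeModels SimpleGraph GadgetSystem ProbeHistory HSiteScheme Contour KNCells
open Literature.Probability.Percolation.KozmaNitzan.Cells (oth sgOf)
open KNCells.KSchA KNLevels ChainPlanar ChainPara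
open Literature.Barriers.CriticalPhenomena (HasExponentialGrowth graphBall graphBall_mono mem_graphBall_self)
open Skel (ReachOblAtHNF excess)
open SkelI (tanOff)
open SkelConc (Consts)
open BoxProdZ2 (ConcRadiiG)
open TwoAxis.Para (modulus)
open Skelφ (oriφ trφ)
open Skelφ.StepI (DataN DataNS OutNS)
open BoxProdZ2 (Erad nQ nS)

export PlanarSkeletonFrm (five_le_Kq_of_le)

/-- **THE (C) COLUMN TARGET OF RECORD, SLOT-ROBUST FORM**: for every slot tuple whose box slot dominates `gFloorKG`/`40·K·R'0` and whose excess slot dominates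
the x- and y-depth floors, and every `Kmin ≥ 160`, the choice function of record `frmChoiceAllQ3V gv fv Pv (SUS ex mx) (cR2W mk) (hFR mk) BSlot.small3` meets the
budgeted corridor obligation `ReachHoldsRHNQFnLK NegB.LfQ Kmin`. [cite: KozmaNitzan2024, §4 Lemma 12, p. 30] -/
theorem reachHoldsRHNQFnLK_frmChoiceAllQ3V_of_le (Kmin : ℕ) (hKmin : 160 ≤ Kmin) (mk : ℕ) {gv fv : Neg.FSlot} {Pv : NegB.PSlot} {ex mx : NegB.GSlot}
    (Hg : ∀ (κ : Consts) {V : Type} [DecidableEq V] [Countable V] {G : SimpleGraph V} [G.LocallyFinite] (Φ : PlanarSkeletonFrmFrom G) (t : V) (p : unitInterval)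
      (D : DataNS V), NegB.gFloorKG κ Φ t p D mk ≤ gv κ Φ t p D ∧ 40 * Neg.K κ * NegB.KS0.R'0 κ Φ t p D mk ≤ gv κ Φ t p D)
    (Hex : ∀ (κ : Consts) {V : Type} [DecidableEq V] [Countable V] {G : SimpleGraph V} [G.LocallyFinite] (Φ : PlanarSkeletonFrmFrom G) (t : V) (p : unitInterval)
      (D : DataNS V) (g f : ℕ), NegB.KS0.r₀0 t D mk (NegB.RLD κ Φ t p D g f) + 3 ≤ ex κ Φ t p D g f ∧ NegB.ZD2 κ Φ t p D g f + 4 ≤ ex κ Φ t p D g f)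
    (HexY : ∀ (κ : Consts) {V : Type} [DecidableEq V] [Countable V] {G : SimpleGraph V} [G.LocallyFinite] (Φ : PlanarSkeletonFrmFrom G) (t : V) (p : unitInterval)
      (D : DataNS V) (g f : ℕ), NegB.KS0.r₀0 t D mk (NegB.RLD κ Φ t p D g f) + 3 ≤ ex κ Φ t p D g f ∧ NegB.ZDYW κ Φ t p D g f + 4 ≤ ex κ Φ t p D g f) :
    ReachHoldsRHNQFnLK NegB.LfQ Kmin (frmChoiceAllQ3V gv fv Pv (NegB.SUS ex mx) (NegB.cR2W mk) (NegB.hFR mk) NegB.BSlot.small3) :=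
  fun κ _ _ _ _ _ Φ _ t _ h1 p hp0 hp1 hC hK => by
  -- G4-B′: row 68's bundle step inlined (was `reachHoldsRHNQFnLK_frmChoiceAllQ3V_of Kmin fun … => NegB.reachHoldsRHNQL_choiceAtQ3V_of h1 hp0 hp1 mk (HX_QV …) (HY_QV …)`)
  show (NegB.choiceAtQ3V κ Φ t p Pv gv fv (NegB.SUS ex mx) (NegB.cR2W mk) (NegB.hFR mk) NegB.BSlot.small3 hC).ReachHoldsRHNQL NegB.LfQ
  intro O q hAt
  refine ⟨NegB.LfQ κ.K₀, le_rfl, ?_⟩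
  obtain ⟨ρ, qq, W, HK, N, aW, Bx, bL, hρ1, hρ2, hρ3, hPl, hPt, hLl, ha, hBx, hbL, haq, hbW, hN, hLt⟩ :=
    NegB.HX_QV (hC := hC) (Pv := Pv) (fv := fv) (mx := mx) mk (five_le_Kq_of_le κ hKmin hK) (Hg κ Φ t p) (Hex κ Φ t p) O q hAt
  obtain ⟨ρ', qq', W', HK', N', aW', Bx', bL', hρ1', hρ2', hρ3', hPR', hLl', ha', hBx', hbL', haW', haW'', hbq', hN', hLt'⟩ :=
    NegB.HY_QV (hC := hC) (Pv := Pv) (fv := fv) (mx := mx) mk (five_le_Kq_of_le κ hKmin hK) (Hg κ Φ t p) (HexY κ Φ t p) O q hAt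
  exact Skel.reachOblRHNOF_of_axes
    (fun h e hrun hc hV hdu hne => NegB.reachOblAtHNF_frmQ3VR_fst hAt h1 hp0 hp1 mk hrun hc hV hdu hne HK N hρ1 hρ2 hρ3 hPl hPt hLl
      (hLt (tgt e)) ha hBx hbL haq hbW hN)
    (fun h e hrun hc hV hdu hne => NegB.reachOblAtHNF_frmQ3VR_sndU hAt h1 hp0 hp1 mk hrun hc hV hdu hne HK' N' hρ1' hρ2' hρ3' hPR' hLl'
      (hLt' (tgt e)) ha' hBx' hbL' haW' haW'' hbq' hN')

end PlanarSkeletonFrmFrom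

end Summit.CriticalPhenomena.PercolationContinuityZ3.Theorems.Transplant

end
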